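import Summits.CriticalPhenomena.PercolationContinuityZ3.Theorems.PercNearOneGluingNoHeavyQuantIndepBlobFarMin
import HarnessLib

/-!
# QUANT lane R8, FAR for independent blobs: "TWO OPEN GATES", conditioned-form core — the algebra behind the floor-resolved
# block-star row `(1 + q)·j` for big (pairwise incompatible) blocks at every floor (`…QuantIndepBlobBigBlockFloorRow`)

builds on p205010 (kernel theorem, internal audit signed; external expert review pending)

Support file (`--supports stmt-CriticalPhenomena-4575`), QUANT lane typer seat prim-quant-stmt (gen 38), rung R8 of
`run/shared/lean/prim/quant/LADDER.md`; memo `run/shared/lean/prim/quant/prim-quant-stmt-g38/BIGBLOCKS-G38.md`.  Part 1 of 2: the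
one-type statements (`IndepBlob.twoOpen_row_min`, `IndepBlob.twoOpen_qform_min`, `IndepBlob.floorRow_bigBlocks_min`) are in
`…QuantIndepBlobBigBlockFloorRow`, which imports this file.

THE STATEMENT PROVED HERE (`IndepBlob.twoOpen_core`, the least-gate block split off as in `far_indepBlob` / `massRow_cond`).  Independent
gates `t ≤ p i ≤ 1` on a finite type `ι` (`k = |ι|` blocks) plus one more block with gate `t` (the least gate).  Write
`w(W) = ∏ (p i if i ∈ W else 1 − p i)`, `A_m = ∑_{#W ≥ m} w`, `P₀ = w(∅)`.  For the full system the probability of at least two open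
gates is `s = t·A₁ + (1 − t)·A₂` and the expected number of open gates is `t + ∑ p i`.  **If `s < t` then `t + ∑ p i ≤ 1 + s`.**
For `j`-blocks behind the gates this is the Q-form `EW ≤ j(1 + P(W > j))` of typer g36's floor-resolved row in the regime
`P(W > j) < least gate`, and (the middle term vanishing for unit blocks) typer g37's Conjecture R `E(N−2)⁺ ≤ P(N = 0)` for this family.

THE PROOF (typer g38; elementary, exact at three gates `1/2⁻`).  `∑ p i = E #open = ∑_W w(W)·#W ≤ A₁ + A₂ + (k − 2)·A₃`
(`sum_gate_eq_sum_bernoulliWeight_mul_card`); `P₀ + A₁ = 1` (`sum_bernoulliWeight_card_lt_one`); so the claim is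
`t·A₂ + (k − 2)·A₃ ≤ (1 − t)·P₀` and the regime is `(1 − t)·A₂ < t·P₀` (hence `t > 0`, `P₀ > 0`, and `t < 1/2` once `k ≥ 2`).  Every
two-element configuration weighs at least `(t/(1−t))²·P₀` (`bernoulliWeight_pair_ge`), so `(1 − t)²·(A₂ − A₃) ≥ C(k,2)·t²·P₀`, and
what is left is the scalar inequality `1 − (k+1)t + (k + (k−2)·C(k,2))·t² ≥ 0` (`twoOpen_scalar`: discriminant
`−(2L³ + 11L² + 18L + 8)`, `L = k − 3 ≥ 0`); `k ≤ 1` is trivial and `k = 2` follows from `t < 1/2` (tight as `t → 1/2`).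

HONEST STATUS: theorems only; `LawDec.TreeBuiltRowFloor`, `Quant.FarTreeRow` stay OPEN; the RATE class log\* and the honest sentence
of `run/shared/lean/prim/quant/README.md` are unchanged.  Prior art searched (typer g38, 2026-08-25; corpus hybrid + vec, galaxy
`star all`): nothing with the gate-wise constant `min p` at threshold `1 + min p` (Hoeffding 1956 treats the extremal gate vectors of
`E g(#open)` at fixed `∑ p`, a different question); recorded as [this work].  The gluing rows served
[cite: KozmaNitzan2024, Conjecture 3 (p. 15)]; product measure [cite: Grimmett1999, §1.3 p. 10].
-/


namespace Summit.CriticalPhenomena.PercolationContinuityZ3.Theorems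

namespace Quant

namespace IndepBlob

open Finset

variable {ι : Type*} [Fintype ι] [DecidableEq ι]

/-- the expected number of open gates is the weighted count: `∑ i, p i = ∑_W w(W)·#W`. [folklore] -/
theorem sum_gate_eq_sum_bernoulliWeight_mul_card (p : ι → ℝ) :
    ∑ i, p i = ∑ W : Finset ι, (∏ k, if k ∈ W then p k else 1 - p k) * (W.card : ℝ) := by
  have h := sum_bernoulliWeight_mul_count p (fun _ => (1 : ℝ))
  simp only [one_mul, Finset.sum_const, nsmul_eq_mul, mul_one] at h
  rw [← h]

/-- only the empty configuration has fewer than one open gate: `∑_{#W < 1} w(W) = ∏ (1 − p k)`. [folklore] -/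
theorem sum_bernoulliWeight_card_lt_one (p : ι → ℝ) :
    ∑ W ∈ (Finset.univ : Finset (Finset ι)).filter (fun W => ¬ (1 ≤ W.card)),
      (∏ k, if k ∈ W then p k else 1 - p k) = ∏ k, (1 - p k) := by
  have hfilter : (Finset.univ : Finset (Finset ι)).filter (fun W => ¬ (1 ≤ W.card)) = {∅} := by
    ext W
    simp only [Finset.mem_filter, Finset.mem_univ, true_and, Finset.mem_singleton, not_le, Nat.lt_one_iff,
      Finset.card_eq_zero]
  rw [hfilter, Finset.sum_singleton]
  exact Finset.prod_congr rfl fun k _ => by simp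

/-- the weight of a two-element configuration against the empty one: for gates `t ≤ p k ≤ 1`,
`(1 − t)²·w({a,b}) ≥ t²·∏(1 − p k)`. [this work] -/
theorem bernoulliWeight_pair_ge (p : ι → ℝ) (t : ℝ) (ht0 : 0 ≤ t) (htp : ∀ k, t ≤ p k) (hp1 : ∀ k, p k ≤ 1)
    (W : Finset ι) (hW : W.card = 2) :
    t ^ 2 * ∏ k, (1 - p k) ≤ (1 - t) ^ 2 * ∏ k, (if k ∈ W then p k else 1 - p k) := by
  obtain ⟨a, b, hab, rfl⟩ := Finset.card_eq_two.1 hW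
  have hb : b ∈ (Finset.univ : Finset ι).erase a := Finset.mem_erase.2 ⟨hab.symm, Finset.mem_univ b⟩
  set R : ℝ := ∏ k ∈ ((Finset.univ : Finset ι).erase a).erase b, (1 - p k) with hR
  have hR0 : 0 ≤ R := Finset.prod_nonneg fun k _ => by linarith [hp1 k]
  have e0 : ∏ k, (1 - p k) = (1 - p a) * ((1 - p b) * R) := by
    rw [← Finset.mul_prod_erase Finset.univ _ (Finset.mem_univ a), ← Finset.mul_prod_erase _ _ hb]
  have e1 : (∏ k, if k ∈ ({a, b} : Finset ι) then p k else 1 - p k) = p a * (p b * R) := by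
    rw [← Finset.mul_prod_erase Finset.univ _ (Finset.mem_univ a), ← Finset.mul_prod_erase _ _ hb,
      if_pos (Finset.mem_insert_self a _), if_pos (Finset.mem_insert_of_mem (Finset.mem_singleton_self b))]
    congr 2
    refine Finset.prod_congr rfl fun k hk => ?_
    rw [Finset.mem_erase, Finset.mem_erase] at hk
    rw [if_neg]
    intro h
    rw [Finset.mem_insert, Finset.mem_singleton] at h
    rcases h with h | h
    · exact hk.2.1 h
    · exact hk.1 h
  rw [e0, e1]
  have ha' : t * (1 - p a) ≤ (1 - t) * p a := by linarith [htp a]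
  have hb' : t * (1 - p b) ≤ (1 - t) * p b := by linarith [htp b]
  have ha0 : 0 ≤ t * (1 - p a) := mul_nonneg ht0 (by linarith [hp1 a])
  have hb0 : 0 ≤ t * (1 - p b) := mul_nonneg ht0 (by linarith [hp1 b])
  have hprod := mul_le_mul ha' hb' hb0 (ha0.trans ha')
  calc t ^ 2 * ((1 - p a) * ((1 - p b) * R)) = (t * (1 - p a)) * (t * (1 - p b)) * R := by ring
    _ ≤ ((1 - t) * p a) * ((1 - t) * p b) * R := mul_le_mul_of_nonneg_right hprod hR0
    _ = (1 - t) ^ 2 * (p a * (p b * R)) := by ring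

/-- the scalar inequality of `twoOpen_core` for `k ≥ 3` blocks besides the least gate:
`1 − (K+1)t + (K + (K−2)·K(K−1)/2)·t² ≥ 0` for `K ≥ 3` and every real `t` (negative discriminant:
`4A − (K+1)² = 2L³ + 11L² + 18L + 8` with `A = K + (K−2)K(K−1)/2`, `L = K − 3`). [this work] -/
theorem twoOpen_scalar (K t : ℝ) (hK3 : 3 ≤ K) :
    0 ≤ 1 - (K + 1) * t + (K + (K - 2) * (K * (K - 1) / 2)) * t ^ 2 := by
  set A : ℝ := K + (K - 2) * (K * (K - 1) / 2) with hA
  have hL : 0 ≤ K - 3 := by linarith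
  have hprod : 0 ≤ (K - 2) * (K * (K - 1) / 2) :=
    mul_nonneg (by linarith) (div_nonneg (mul_nonneg (by linarith) (by linarith)) (by norm_num))
  have hApos : 0 < A := by rw [hA]; linarith
  have hdisc : 4 * A - (K + 1) ^ 2 = 2 * (K - 3) ^ 3 + 11 * (K - 3) ^ 2 + 18 * (K - 3) + 8 := by
    rw [hA]; ring
  have hdisc0 : 0 ≤ 4 * A - (K + 1) ^ 2 := by
    rw [hdisc]
    have h3 : 0 ≤ (K - 3) ^ 3 := pow_nonneg hL 3
    have h2 : 0 ≤ (K - 3) ^ 2 := pow_nonneg hL 2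
    linarith
  have key : 4 * A * (1 - (K + 1) * t + A * t ^ 2) = (2 * A * t - (K + 1)) ^ 2 + (4 * A - (K + 1) ^ 2) := by ring
  have h4 : 0 ≤ 4 * A * (1 - (K + 1) * t + A * t ^ 2) := by
    rw [key]; exact add_nonneg (sq_nonneg _) hdisc0
  by_contra hneg
  have : 4 * A * (1 - (K + 1) * t + A * t ^ 2) < 0 := mul_neg_of_pos_of_neg (by linarith) (not_le.1 hneg)
  linarith

/-- **CORE (conditioned form).**  Gates `t ≤ p i ≤ 1` on a finite type `ι` (the blocks other than the least-gate block, whose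
gate is `t ≤ 1`), weights `w(W) = ∏ (p k if k ∈ W else 1 − p k)`, `A₁ = ∑_{#W ≥ 1} w`, `A₂ = ∑_{#W ≥ 2} w`.  For the full system
(the `ι`-blocks plus the `t`-block) the probability of at least two open gates is `s = t·A₁ + (1 − t)·A₂` and the expected number
of open gates is `t + ∑ p i`.  **If `s < t` then `t + ∑ i, p i ≤ 1 + s`.**  Proof: `∑ p i = ∑_W w(W)·#W ≤ A₁ + A₂ + (k − 2)·A₃`
(`k = |ι|`, `A₃ = ∑_{#W ≥ 3} w`), the regime gives `(1 − t)·A₂ < t·P₀` (`P₀ = w(∅)`), every two-element configuration has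
`(1 − t)² w ≥ t² P₀` so `(1 − t)²(A₂ − A₃) ≥ C(k,2) t² P₀`, and the remaining scalar inequality is
`1 − (k+1)t + (k + (k−2)·C(k,2)) t² ≥ 0` (negative discriminant for `k ≥ 3`; `k ≤ 2` directly, using `t < 1/2`, which the
regime forces when `k ≥ 2`). [this work] -/
theorem twoOpen_core (p : ι → ℝ) (t : ℝ) (hp1 : ∀ i, p i ≤ 1) (htp : ∀ i, t ≤ p i) (ht0 : 0 ≤ t) (ht1 : t ≤ 1)
    (hreg : t * (∑ W ∈ (Finset.univ : Finset (Finset ι)).filter (fun W => 1 ≤ W.card),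
        (∏ k, if k ∈ W then p k else 1 - p k)) +
      (1 - t) * (∑ W ∈ (Finset.univ : Finset (Finset ι)).filter (fun W => 2 ≤ W.card),
        (∏ k, if k ∈ W then p k else 1 - p k)) < t) :
    t + ∑ i, p i ≤ 1 + (t * (∑ W ∈ (Finset.univ : Finset (Finset ι)).filter (fun W => 1 ≤ W.card),
        (∏ k, if k ∈ W then p k else 1 - p k)) +
      (1 - t) * (∑ W ∈ (Finset.univ : Finset (Finset ι)).filter (fun W => 2 ≤ W.card),
        (∏ k, if k ∈ W then p k else 1 - p k))) := by
  set A1 := ∑ W ∈ (Finset.univ : Finset (Finset ι)).filter (fun W => 1 ≤ W.card),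
        (∏ k, if k ∈ W then p k else 1 - p k) with hA1
  set A2 := ∑ W ∈ (Finset.univ : Finset (Finset ι)).filter (fun W => 2 ≤ W.card),
        (∏ k, if k ∈ W then p k else 1 - p k) with hA2
  set A3 := ∑ W ∈ (Finset.univ : Finset (Finset ι)).filter (fun W => 3 ≤ W.card),
        (∏ k, if k ∈ W then p k else 1 - p k) with hA3
  set B2 := ∑ W ∈ (Finset.univ : Finset (Finset ι)).filter (fun W => W.card = 2),
        (∏ k, if k ∈ W then p k else 1 - p k) with hB2
  set P0 : ℝ := ∏ k, (1 - p k) with hP0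
  set K : ℝ := (Fintype.card ι : ℝ) with hK
  have hp0 : ∀ i, 0 ≤ p i := fun i => ht0.trans (htp i)
  have hw0 : ∀ W : Finset ι, 0 ≤ (∏ k, if k ∈ W then p k else 1 - p k) := bernoulliWeight_nonneg hp0 hp1
  have hA1n : 0 ≤ A1 := Finset.sum_nonneg fun W _ => hw0 W
  have hA2n : 0 ≤ A2 := Finset.sum_nonneg fun W _ => hw0 W
  have hA3n : 0 ≤ A3 := Finset.sum_nonneg fun W _ => hw0 W
  have hB2n : 0 ≤ B2 := Finset.sum_nonneg fun W _ => hw0 W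
  have hP0n : 0 ≤ P0 := Finset.prod_nonneg fun k _ => by linarith [hp1 k]
  -- `P₀ + A₁ = 1`
  have hPA : P0 + A1 = 1 := by
    rw [hP0, ← sum_bernoulliWeight_card_lt_one p, hA1, add_comm,
      Finset.sum_filter_add_sum_filter_not, sum_bernoulliWeight]
  -- filtered sums as indicator sums
  have hind : ∀ (P : Finset ι → Prop) [DecidablePred P],
      ∑ W : Finset ι, (∏ k, if k ∈ W then p k else 1 - p k) * (if P W then (1 : ℝ) else 0) =
        ∑ W ∈ (Finset.univ : Finset (Finset ι)).filter P, (∏ k, if k ∈ W then p k else 1 - p k) := by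
    intro P _
    rw [Finset.sum_filter]
    exact Finset.sum_congr rfl fun W _ => by split_ifs <;> simp
  -- `∑ p i ≤ A₁ + A₂ + (K − 2)·A₃`
  have hEN : ∑ i, p i ≤ A1 + A2 + (K - 2) * A3 := by
    rw [sum_gate_eq_sum_bernoulliWeight_mul_card]
    have hpt : ∀ W : Finset ι, (W.card : ℝ) ≤
        (if 1 ≤ W.card then (1 : ℝ) else 0) + (if 2 ≤ W.card then (1 : ℝ) else 0) +
          (K - 2) * (if 3 ≤ W.card then (1 : ℝ) else 0) := by
      intro W
      have hk : W.card ≤ Fintype.card ι := Finset.card_le_univ W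
      have hkR : (W.card : ℝ) ≤ K := by rw [hK]; exact_mod_cast hk
      by_cases h3 : 3 ≤ W.card
      · rw [if_pos (by omega), if_pos (by omega), if_pos h3]; linarith
      · by_cases h2 : 2 ≤ W.card
        · rw [if_pos (by omega), if_pos h2, if_neg h3]
          have : (W.card : ℝ) = 2 := by exact_mod_cast (by omega : W.card = 2)
          linarith
        · by_cases h1 : 1 ≤ W.card
          · rw [if_pos h1, if_neg h2, if_neg h3]
            have : (W.card : ℝ) = 1 := by exact_mod_cast (by omega : W.card = 1)
            linarith
          · rw [if_neg h1, if_neg h2, if_neg h3]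
            have : (W.card : ℝ) = 0 := by exact_mod_cast (by omega : W.card = 0)
            linarith
    calc ∑ W : Finset ι, (∏ k, if k ∈ W then p k else 1 - p k) * (W.card : ℝ)
        ≤ ∑ W : Finset ι, (∏ k, if k ∈ W then p k else 1 - p k) *
            ((if 1 ≤ W.card then (1 : ℝ) else 0) + (if 2 ≤ W.card then (1 : ℝ) else 0) +
              (K - 2) * (if 3 ≤ W.card then (1 : ℝ) else 0)) :=
          Finset.sum_le_sum fun W _ => mul_le_mul_of_nonneg_left (hpt W) (hw0 W)
      _ = A1 + A2 + (K - 2) * A3 := by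
          have e : ∀ W : Finset ι, (∏ k, if k ∈ W then p k else 1 - p k) *
              ((if 1 ≤ W.card then (1 : ℝ) else 0) + (if 2 ≤ W.card then (1 : ℝ) else 0) +
                (K - 2) * (if 3 ≤ W.card then (1 : ℝ) else 0)) =
              (∏ k, if k ∈ W then p k else 1 - p k) * (if 1 ≤ W.card then (1 : ℝ) else 0) +
              (∏ k, if k ∈ W then p k else 1 - p k) * (if 2 ≤ W.card then (1 : ℝ) else 0) +
              (K - 2) * ((∏ k, if k ∈ W then p k else 1 - p k) * (if 3 ≤ W.card then (1 : ℝ) else 0)) :=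
            fun W => by ring
          rw [Finset.sum_congr rfl fun W _ => e W, Finset.sum_add_distrib, Finset.sum_add_distrib,
            ← Finset.mul_sum, hind, hind, hind]
  -- `A₂ = B₂ + A₃`
  have hA23 : A2 = B2 + A3 := by
    rw [hA2, hB2, hA3, ← Finset.sum_filter_add_sum_filter_not
      ((Finset.univ : Finset (Finset ι)).filter (fun W => 2 ≤ W.card)) (fun W => W.card = 2),
      Finset.filter_filter, Finset.filter_filter]
    congr 1
    · refine Finset.sum_congr ?_ fun _ _ => rfl
      ext W
      simp only [Finset.mem_filter, Finset.mem_univ, true_and]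
      omega
    · refine Finset.sum_congr ?_ fun _ _ => rfl
      ext W
      simp only [Finset.mem_filter, Finset.mem_univ, true_and]
      omega
  -- `(1 − t)²·B₂ ≥ C(k,2)·t²·P₀`
  have hB2ge : ((Fintype.card ι).choose 2 : ℝ) * (t ^ 2 * P0) ≤ (1 - t) ^ 2 * B2 := by
    rw [hB2, Finset.mul_sum]
    have hcard : ((Finset.univ : Finset (Finset ι)).filter (fun W => W.card = 2)).card =
        (Fintype.card ι).choose 2 := by
      rw [Finset.univ_filter_card_eq, Finset.card_powersetCard, Finset.card_univ]
    calc ((Fintype.card ι).choose 2 : ℝ) * (t ^ 2 * P0)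
        = ∑ W ∈ (Finset.univ : Finset (Finset ι)).filter (fun W => W.card = 2), t ^ 2 * P0 := by
          rw [Finset.sum_const, hcard, nsmul_eq_mul]
      _ ≤ ∑ W ∈ (Finset.univ : Finset (Finset ι)).filter (fun W => W.card = 2),
            (1 - t) ^ 2 * (∏ k, if k ∈ W then p k else 1 - p k) :=
          Finset.sum_le_sum fun W hW => by
            rw [Finset.mem_filter] at hW
            exact bernoulliWeight_pair_ge p t ht0 htp hp1 W hW.2
  -- the regime: `(1 − t)·A₂ < t·P₀`, hence `t > 0`, `P₀ > 0`
  have htPA : t * P0 + t * A1 = t := by rw [← mul_add, hPA, mul_one]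
  have hreg' : (1 - t) * A2 < t * P0 := by linarith
  have htpos : 0 < t := by linarith [mul_nonneg ht0 hA1n, mul_nonneg (sub_nonneg.2 ht1) hA2n]
  have hP0pos : 0 < P0 := by
    by_contra h
    have hP00 : P0 = 0 := le_antisymm (not_lt.1 h) hP0n
    rw [hP00, mul_zero] at hreg'
    exact absurd hreg' (not_lt.2 (mul_nonneg (sub_nonneg.2 ht1) hA2n))
  -- the goal in reduced form
  suffices hmain : t * A2 + (K - 2) * A3 ≤ (1 - t) * P0 by linarith [hPA, hEN, htPA]
  -- case `|ι| ≤ 1`: no configuration has two open gates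
  by_cases hk1 : Fintype.card ι ≤ 1
  · have e2 : A2 = 0 := by
      rw [hA2]
      refine Finset.sum_eq_zero fun W hW => ?_
      rw [Finset.mem_filter] at hW
      have := Finset.card_le_univ W
      omega
    have e3 : A3 = 0 := by
      rw [hA3]
      refine Finset.sum_eq_zero fun W hW => ?_
      rw [Finset.mem_filter] at hW
      have := Finset.card_le_univ W
      omega
    rw [e2, e3, mul_zero, mul_zero, add_zero]
    exact mul_nonneg (sub_nonneg.2 ht1) hP0n
  -- `|ι| ≥ 2`: then `1 − t > 0` and `t < 1/2`
  have hk2 : 2 ≤ Fintype.card ι := by omega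
  have hC1 : (1 : ℝ) ≤ ((Fintype.card ι).choose 2 : ℝ) := by
    have : 1 ≤ (Fintype.card ι).choose 2 := Nat.succ_le_of_lt (Nat.choose_pos hk2)
    exact_mod_cast this
  have hX : t ^ 2 * P0 ≤ (1 - t) ^ 2 * A2 := by
    have h1 : t ^ 2 * P0 ≤ ((Fintype.card ι).choose 2 : ℝ) * (t ^ 2 * P0) := by
      have := mul_le_mul_of_nonneg_right hC1 (mul_nonneg (sq_nonneg t) hP0n)
      linarith
    have h2 : (1 - t) ^ 2 * B2 ≤ (1 - t) ^ 2 * A2 :=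
      mul_le_mul_of_nonneg_left (by linarith [hA23]) (sq_nonneg _)
    linarith [hB2ge]
  have h1t : 0 < 1 - t := by
    rcases eq_or_lt_of_le (sub_nonneg.2 ht1) with h | h
    · exfalso
      rw [← h] at hX
      have : 0 < t ^ 2 * P0 := mul_pos (pow_pos htpos 2) hP0pos
      norm_num at hX
      linarith
    · exact h
  have hthalf : t < 1 - t := by
    have h1 : (1 - t) ^ 2 * ((1 - t) * A2) < (1 - t) ^ 2 * (t * P0) := mul_lt_mul_of_pos_left hreg' (pow_pos h1t 2)
    have h2 : (1 - t) * (t ^ 2 * P0) ≤ (1 - t) * ((1 - t) ^ 2 * A2) := mul_le_mul_of_nonneg_left hX h1t.le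
    have e2 : (1 - t) * ((1 - t) ^ 2 * A2) = (1 - t) ^ 2 * ((1 - t) * A2) := by ring
    rw [e2] at h2
    have h3 := h2.trans_lt h1
    have e3 : (1 - t) * (t ^ 2 * P0) = ((1 - t) * t * P0) * t := by ring
    have e4 : (1 - t) ^ 2 * (t * P0) = ((1 - t) * t * P0) * (1 - t) := by ring
    rw [e3, e4] at h3
    exact lt_of_mul_lt_mul_left h3 (mul_nonneg (mul_nonneg h1t.le htpos.le) hP0n)
  by_cases hk3 : Fintype.card ι = 2
  · -- `|ι| = 2`: `A₃ = 0` and `t·A₂ ≤ (1−t)·A₂ < t·P₀ ≤ (1−t)·P₀`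
    have e3 : A3 = 0 := by
      rw [hA3]
      refine Finset.sum_eq_zero fun W hW => ?_
      rw [Finset.mem_filter] at hW
      have := Finset.card_le_univ W
      omega
    have hK2 : K = 2 := by rw [hK]; exact_mod_cast hk3
    rw [e3, mul_zero, add_zero]
    linarith [mul_le_mul_of_nonneg_right hthalf.le hA2n, mul_le_mul_of_nonneg_right hthalf.le hP0n]
  -- `|ι| ≥ 3`: the scalar inequality
  have hK3 : (3 : ℝ) ≤ K := by rw [hK]; exact_mod_cast (by omega : 3 ≤ Fintype.card ι)
  set C : ℝ := ((Fintype.card ι).choose 2 : ℝ) with hC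
  have hCval : C = K * (K - 1) / 2 := by rw [hC, hK, Nat.cast_choose_two]
  rw [hCval] at hB2ge
  set Q : ℝ := 1 - (K + 1) * t + (K + (K - 2) * (K * (K - 1) / 2)) * t ^ 2 with hQ
  have hQ0 : 0 ≤ Q := twoOpen_scalar K t hK3
  have s1 : (1 - t) ^ 2 * (t * A2 + (K - 2) * A3) =
      (1 - t) * (t + K - 2) * ((1 - t) * A2) - (K - 2) * ((1 - t) ^ 2 * B2) := by
    rw [hA23]; ring
  have s2 : (1 - t) * (t + K - 2) * ((1 - t) * A2) ≤ (1 - t) * (t + K - 2) * (t * P0) :=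
    mul_le_mul_of_nonneg_left hreg'.le (mul_nonneg h1t.le (by linarith))
  have s3 : (K - 2) * (K * (K - 1) / 2 * (t ^ 2 * P0)) ≤ (K - 2) * ((1 - t) ^ 2 * B2) :=
    mul_le_mul_of_nonneg_left hB2ge (by linarith)
  have s4 : (1 - t) * (t + K - 2) * (t * P0) - (K - 2) * (K * (K - 1) / 2 * (t ^ 2 * P0)) =
      P0 * ((1 - t) ^ 3 - Q) := by
    rw [hQ]; ring
  have s5 : (1 - t) ^ 2 * (t * A2 + (K - 2) * A3) ≤ (1 - t) ^ 2 * ((1 - t) * P0) := by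
    rw [s1]
    have e : (1 - t) ^ 2 * ((1 - t) * P0) = P0 * ((1 - t) ^ 3 - Q) + P0 * Q := by ring
    rw [e]
    linarith [mul_nonneg hP0n hQ0]
  exact le_of_mul_le_mul_left s5 (pow_pos h1t 2)

end IndepBlob

end Quant

end Summit.CriticalPhenomena.PercolationContinuityZ3.Theorems
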